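import Summits.AtomisticToContinuum.Crystallization.Theses.FrustrationRangeCertificates
import Summits.AtomisticToContinuum.Crystallization.Theses.PalmUnimodularRigidity
import Summits.AtomisticToContinuum.Crystallization.Theorems.FrustrationRangeCertificatesPatternPricedCertificatesSplit

/-!
# Line `palm-split` — crux `PatternPricedCertificates` (stmt-AtomisticToContinuum-12974), route `FrustrationRangeCertificates`
# (strategist's ALTERNATIVE line; the live skeleton `Lines/birth.lean` is untouched)

The crux X is, by theorems of the tree only, a COROLLARY of the two open content cruxes of `PalmRigidity`
(stmt-AtomisticToContinuum-9224, route `PalmUnimodularRigidity`):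

  X ⇐ PalmRigidity                      (`patternPricedCertificates_of_palmRigidity_alone`, Split.lean p171947 — the line
                                          `registered` end state with B5' = `stub_hcpUniqueMinimiser` DISCHARGED from the landed
                                          certified hcp numerics `stub_relaxedReference` + `tube_hcpE_unique_minimiser`)
  PalmRigidity ⇐ MinimiserShells → ShellsToBarlowChart → LayeredLawsSelectHcp
                                         (closed glue item stmt-9228 `cruxesToPalmRigidity_proof`; stmt-9227 CLOSED `ShellsToBarlowChart_of`).

So the two registered stubs of this line are EXACTLY the shared items stmt-AtomisticToContinuum-9225 (`MinimiserShells`) and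
stmt-AtomisticToContinuum-9226 (`LayeredLawsSelectHcp`), stated BY NAME over the existing route decls (no re-typing), and the
composition `PatternPricedCertificates_of` is the landed split theorem `PatternPricedCertificates_of_subs`.

DO NOT attack the two stubs inside this crux workspace: they are staffed items with their own crux workspaces
(`Cruxes/MinimiserShells/…`, `Cruxes/LayeredLawsSelectHcp/…` of route PalmUnimodularRigidity). This line exists (i) to be CLOSED BY
NAME the moment those items close (`theorem … : PatternPricedCertificates := PatternPricedCertificates_of_subs ‹9225› ‹9226›`), and
(ii) as the kernel-checked certificate of the strategist's decomposition `route edit --split PatternPricedCertificates --into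
MinimiserShells LayeredLawsSelectHcp --glue-by …PatternPricedCertificates_of_subs` (children.json in the strategist folder / card).
-/

namespace Summit.AtomisticToContinuum.Crystallization.Cruxes.PatternPricedCertificates.PalmSplit

/-- stub 1 = shared item stmt-AtomisticToContinuum-9225 (crux rank 2 of route PalmUnimodularRigidity), BY NAME: measure-level local
structure — every minimising point-stationary hard-core law has a.s. a (1/100)-close-packed (fcc- or hcp-type) first shell at the root. -/
theorem stub_minimiserShells :
    Summit.AtomisticToContinuum.Crystallization.Theses.PalmUnimodularRigidity.MinimiserShells := by
  sorry

/-- stub 2 = shared item stmt-AtomisticToContinuum-9226 (crux rank 3 of route PalmUnimodularRigidity), BY NAME: selection and rigidity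
in density form — a minimising point-stationary law carried by Barlow-charted close-packed configurations is a.s. an exact rotated relaxed
hcp crystal with optimal parameters. -/
theorem stub_layeredLawsSelectHcp :
    Summit.AtomisticToContinuum.Crystallization.Theses.PalmUnimodularRigidity.LayeredLawsSelectHcp := by
  sorry

/-- The composition, kernel-checked and sorry-free: the crux BY NAME from the two stubs (landed split theorem
`PatternPricedCertificates_of_subs`, Theorems/FrustrationRangeCertificatesPatternPricedCertificatesSplit.lean, p171947). -/
theorem PatternPricedCertificates_of :
    Summit.AtomisticToContinuum.Crystallization.Theses.PalmUnimodularRigidity.MinimiserShells →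
      Summit.AtomisticToContinuum.Crystallization.Theses.PalmUnimodularRigidity.LayeredLawsSelectHcp →
        Summit.AtomisticToContinuum.Crystallization.Theses.FrustrationRangeCertificates.PatternPricedCertificates :=
  Summit.AtomisticToContinuum.Crystallization.Theorems.PatternPricedCertificates.PatternPricedCertificates_of_subs

/-- The crux by name, modulo the two stubs. -/
theorem PatternPricedCertificates_holds_of_stubs :
    Summit.AtomisticToContinuum.Crystallization.Theses.FrustrationRangeCertificates.PatternPricedCertificates :=
  PatternPricedCertificates_of stub_minimiserShells stub_layeredLawsSelectHcp

end Summit.AtomisticToContinuum.Crystallization.Cruxes.PatternPricedCertificates.PalmSplit
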